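import Mathlib
import HarnessLib

/-!
# The `k`-disjointness matrix has full rank (Razborov 1987)

S. Jukna, *Extremal Combinatorics — with applications in computer science* (1st ed., Springer 2001)
[Jukna2001], Chapter 14 "The basic method", §14.2.3 "Disjointness matrices", Theorem 14.10
 with the proof of Razborov (1987) printed there; original: A. A. Razborov, *Lower bounds on
the size of bounded depth circuits over a complete basis with logical addition*, Mat. Zametki 41
(1987) 598–607 [Razborov1987].

Let `k ≤ n` and `X` an `n`-set.  The `k`-disjointness matrix `D = D(n,k)` is the `0`-`1` matrix
whose rows and columns are labelled by the subsets of `X` of size at most `k`, with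
`D_{A,B} = 1` iff `A ∩ B = ∅`.  **Theorem 14.10.** `D` has full rank over `𝔽₂`:
`rk_{𝔽₂}(D) = Σ_{i=0}^{k} C(n,i)`.

PROVED here (theorems only, no named facts), over an ARBITRARY field `F` (the printed statement is
the case `F = 𝔽₂`, `rank_disjointnessMatrix_zmod_two`), for any matrix `D` indexed by
`{A : Finset α // |A| ≤ k}` with `D A B = [A ∩ B = ∅]`.  The text notes that the result is
"usually derived from more general facts about Möbius inversion"; we follow that route, which is
the same computation as Razborov's substitution `x_i := 1 (i ∉ I₀)`: if `λ ≠ 0` is a row relation,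
choose `I₀` in its support of maximal size (so `λ_I = 0` for all `I ⊋ I₀`, as in the printed
proof); for every `J ⊆ I₀` the `J`-th coordinate of `λ·D` is `h(J) = Σ_I λ_I [I ∩ J = ∅]`, and
`Σ_{J ⊆ I₀} (−1)^{|J|} h(J) = Σ_I λ_I [I₀ ⊆ I] = λ_{I₀} ≠ 0`, so some coordinate of `λ·D` with
`|J| ≤ k` is nonzero — the conclusion of the printed proof.
* `sum_powerset_neg_one_pow_card_field` — `Σ_{J ⊆ S} (−1)^{|J|} = [S = ∅]` in a field;
* `sum_neg_one_pow_mul_disjoint_indicator` — `Σ_{J ⊆ I₀} (−1)^{|J|} [I ∩ J = ∅] = [I₀ ⊆ I]`;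
* **`linearIndependent_rows_disjointnessMatrix`** — the rows of `D` are linearly independent;
* **`isUnit_disjointnessMatrix`**, `card_subsets_card_le` (`|{A : |A| ≤ k}| = Σ_{i ≤ k} C(n,i)`),
  **`rank_disjointnessMatrix`** (`rk D = Σ_{i ≤ k} C(n,i)`), `rank_disjointnessMatrix_zmod_two`
  (Theorem 14.10 as printed, over `𝔽₂`).

## References

* [Jukna2001] S. Jukna, *Extremal Combinatorics*, 1st ed., Springer (2001), Theorem 14.10 and its
  proof (held text `book:jukna2011-extremal-combinatorics-with-applications-computer-science`,
  chunk 175).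
* [Razborov1987] A. A. Razborov, Mat. Zametki 41 (1987) 598–607 (Math. Notes 41, 333–338).
-/

namespace Literature.Combinatorics.SetFamily

open Finset

variable {α : Type*} [DecidableEq α]

/-! ### Möbius-inversion identities -/

/-- `Σ_{J ⊆ S} (−1)^{|J|} = [S = ∅]` (in any field; Mathlib's `Finset.sum_powerset_neg_one_pow_card`
is the integer statement). [cite: Jukna2001, Ch. 14 §14.2.3 ("usually derived from more general
facts about Möbius inversion")] -/
theorem sum_powerset_neg_one_pow_card_field {F : Type*} [Field F] (S : Finset α) :
    ∑ J ∈ S.powerset, (-1 : F) ^ J.card = if S = ∅ then 1 else 0 := by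
  have h := congrArg (Int.cast : ℤ → F) (Finset.sum_powerset_neg_one_pow_card (x := S))
  push_cast at h
  rw [h]

/-- `Σ_{J ⊆ I₀} (−1)^{|J|} [I ∩ J = ∅] = [I₀ ⊆ I]`: the subsets of `I₀` disjoint from `I` are the
subsets of `I₀ \ I`. [cite: Jukna2001, Ch. 14 §14.2.3, proof of Theorem 14.10 (the substitution
`x_i := 1` for `i ∉ I₀`: "`∏_{i ∈ I} b_i = 1` if and only if `I ∩ J₀ = ∅`")] -/
theorem sum_neg_one_pow_mul_disjoint_indicator {F : Type*} [Field F] (I₀ I : Finset α) :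
    ∑ J ∈ I₀.powerset, (-1 : F) ^ J.card * (if Disjoint I J then 1 else 0) =
      if I₀ ⊆ I then 1 else 0 := by
  simp_rw [mul_boole]
  rw [← Finset.sum_filter]
  have hfilter : I₀.powerset.filter (fun J => Disjoint I J) = (I₀ \ I).powerset := by
    ext J
    simp only [Finset.mem_filter, Finset.mem_powerset, Finset.subset_sdiff, disjoint_comm]
  rw [hfilter, sum_powerset_neg_one_pow_card_field]
  exact if_congr Finset.sdiff_eq_empty_iff_subset rfl rfl

/-! ### Theorem 14.10 -/

section DisjointnessMatrix

variable [Fintype α] {F : Type*} [Field F] {k : ℕ}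

/-- **The rows of the `k`-disjointness matrix are linearly independent** (over any field).
Printed proof (Razborov): for a nonzero `λ` pick `I₀` with `λ_{I₀} ≠ 0` and `λ_I = 0` for all
`I ⊋ I₀`; then the coordinate of `λ·D` at some `J₀ ⊆ I₀` is nonzero.  Here: `I₀` of maximal size
in the support, and `Σ_{J ⊆ I₀} (−1)^{|J|} (λ·D)_J = λ_{I₀}`.
[cite: Jukna2001, Ch. 14 §14.2.3, Theorem 14.10 and its proof; Razborov1987] -/
theorem linearIndependent_rows_disjointnessMatrix
    (D : Matrix {A : Finset α // A.card ≤ k} {A : Finset α // A.card ≤ k} F)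
    (hD : ∀ I J, D I J = if Disjoint I.1 J.1 then 1 else 0) :
    LinearIndependent F (fun I => D I) := by
  classical
  rw [Fintype.linearIndependent_iff]
  intro g hrel
  -- coordinates of the relation: `h(J) = Σ_I λ_I [I ∩ J = ∅] = 0` for `|J| ≤ k`
  have hcoord : ∀ J : Finset α, J.card ≤ k →
      ∑ I, g I * (if Disjoint I.1 J then (1 : F) else 0) = 0 := by
    intro J hJ
    have h := congrFun hrel ⟨J, hJ⟩
    simpa only [Finset.sum_apply, Pi.smul_apply, smul_eq_mul, Pi.zero_apply, hD] using h
  by_contra hne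
  push Not at hne
  -- `I₀` of maximal size in the support
  obtain ⟨I₀, hI₀, hmax⟩ : ∃ I₀ ∈ Finset.univ.filter (fun I => g I ≠ 0),
      ∀ I ∈ Finset.univ.filter (fun I => g I ≠ 0), I.1.card ≤ I₀.1.card := by
    obtain ⟨I, hI⟩ := hne
    have hI' : I ∈ Finset.univ.filter (fun I => g I ≠ 0) :=
      Finset.mem_filter.mpr ⟨Finset.mem_univ _, hI⟩
    exact Finset.exists_max_image _ (fun I => I.1.card) ⟨I, hI'⟩
  rw [Finset.mem_filter] at hI₀
  have hsup : ∀ I : {A : Finset α // A.card ≤ k}, I₀.1 ⊆ I.1 → I ≠ I₀ → g I = 0 := by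
    intro I hsub hne'
    by_contra hgI
    have hle := hmax I (Finset.mem_filter.mpr ⟨Finset.mem_univ _, hgI⟩)
    exact hne' (Subtype.ext (Finset.eq_of_subset_of_card_le hsub hle).symm)
  -- the alternating sum of the coordinates over `J ⊆ I₀` vanishes …
  have hsum : ∑ J ∈ I₀.1.powerset, (-1 : F) ^ J.card *
      ∑ I, g I * (if Disjoint I.1 J then (1 : F) else 0) = 0 := by
    refine Finset.sum_eq_zero fun J hJ => ?_
    rw [hcoord J ((Finset.card_le_card (Finset.mem_powerset.mp hJ)).trans I₀.2), mul_zero]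
  -- … and equals `λ_{I₀}`
  have hsum' : ∑ J ∈ I₀.1.powerset, (-1 : F) ^ J.card *
      ∑ I, g I * (if Disjoint I.1 J then (1 : F) else 0) = g I₀ := by
    calc ∑ J ∈ I₀.1.powerset, (-1 : F) ^ J.card *
          ∑ I, g I * (if Disjoint I.1 J then (1 : F) else 0)
        = ∑ I, ∑ J ∈ I₀.1.powerset,
            g I * ((-1 : F) ^ J.card * (if Disjoint I.1 J then (1 : F) else 0)) := by
          simp_rw [Finset.mul_sum]
          rw [Finset.sum_comm]
          exact Finset.sum_congr rfl fun I _ => Finset.sum_congr rfl fun J _ => by ring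
      _ = ∑ I, g I * (if I₀.1 ⊆ I.1 then (1 : F) else 0) := by
          refine Finset.sum_congr rfl fun I _ => ?_
          rw [← Finset.mul_sum, sum_neg_one_pow_mul_disjoint_indicator]
      _ = g I₀ := by
          rw [Finset.sum_eq_single I₀]
          · simp
          · intro I _ hI
            by_cases hsub : I₀.1 ⊆ I.1
            · rw [hsup I hsub hI, zero_mul]
            · rw [if_neg hsub, mul_zero]
          · intro h; exact absurd (Finset.mem_univ _) h
  exact hI₀.2 (hsum'.symm.trans hsum)

/-- **The `k`-disjointness matrix is nonsingular** (over any field).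
[cite: Jukna2001, Ch. 14 §14.2.3, Theorem 14.10; Razborov1987] -/
theorem isUnit_disjointnessMatrix
    (D : Matrix {A : Finset α // A.card ≤ k} {A : Finset α // A.card ≤ k} F)
    (hD : ∀ I J, D I J = if Disjoint I.1 J.1 then 1 else 0) : IsUnit D :=
  Matrix.linearIndependent_rows_iff_isUnit.mp (linearIndependent_rows_disjointnessMatrix D hD)

/-- The number of subsets of size at most `k` of an `n`-set is `Σ_{i=0}^{k} C(n,i)`.
[cite: Jukna2001, Ch. 14 §14.2.3 ("all its `Σ_{i=0}^k C(n,i)` rows")] -/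
theorem card_subsets_card_le (k : ℕ) :
    Fintype.card {A : Finset α // A.card ≤ k} =
      ∑ i ∈ Finset.range (k + 1), (Fintype.card α).choose i := by
  classical
  rw [Fintype.card_subtype]
  have hdecomp : (Finset.univ : Finset (Finset α)).filter (fun A => A.card ≤ k) =
      (Finset.range (k + 1)).biUnion (fun i => Finset.powersetCard i Finset.univ) := by
    ext A
    simp only [Finset.mem_filter, Finset.mem_univ, true_and, Finset.mem_biUnion, Finset.mem_range,
      Finset.mem_powersetCard, Finset.subset_univ]
    constructor
    · intro h; exact ⟨A.card, Nat.lt_succ_of_le h, rfl⟩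
    · rintro ⟨i, hi, rfl⟩; omega
  rw [hdecomp, Finset.card_biUnion]
  · exact Finset.sum_congr rfl fun i _ => by rw [Finset.card_powersetCard, Finset.card_univ]
  · intro i _ j _ hij
    rw [Function.onFun, Finset.disjoint_left]
    intro A hAi hAj
    rw [Finset.mem_powersetCard] at hAi hAj
    exact hij (hAi.2.symm.trans hAj.2)

/-- **Theorem 14.10 (over any field): `rk D(n,k) = Σ_{i=0}^{k} C(n,i)`.**
[cite: Jukna2001, Ch. 14 §14.2.3, Theorem 14.10; Razborov1987] -/
theorem rank_disjointnessMatrix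
    (D : Matrix {A : Finset α // A.card ≤ k} {A : Finset α // A.card ≤ k} F)
    (hD : ∀ I J, D I J = if Disjoint I.1 J.1 then 1 else 0) :
    D.rank = ∑ i ∈ Finset.range (k + 1), (Fintype.card α).choose i := by
  classical
  rw [Matrix.rank_of_isUnit D (isUnit_disjointnessMatrix D hD), card_subsets_card_le]

/-- **Theorem 14.10 as printed (Razborov 1987): the `k`-disjointness matrix has full rank over
`𝔽₂`, `rk_{𝔽₂}(D) = Σ_{i=0}^{k} C(n,i)`.** [cite: Jukna2001, Ch. 14 §14.2.3, Theorem 14.10;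
Razborov1987] -/
theorem rank_disjointnessMatrix_zmod_two
    (D : Matrix {A : Finset α // A.card ≤ k} {A : Finset α // A.card ≤ k} (ZMod 2))
    (hD : ∀ I J, D I J = if Disjoint I.1 J.1 then 1 else 0) :
    D.rank = ∑ i ∈ Finset.range (k + 1), (Fintype.card α).choose i :=
  rank_disjointnessMatrix D hD

end DisjointnessMatrix

end Literature.Combinatorics.SetFamily
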